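import Mathlib
import Summits.Ventures.HodgeRepro.Tier4.Line4.SeesawPlaneInstance
import Summits.Ventures.HodgeRepro.Tier4.Line4.SylvesterLines

/-!
# Tier4/Line4/SeesawPlaneData — C-L4-PLANE-INSTANCE closed by name: the wall's (A1)+(A2) binders from `TargetData` ALONE

Blind re-derivation cell `pub-hodge-repro`, Tier 4 «prove the step» (README §9–§10), seat t4-L1-p1 g5 (prover, LINE L4
chair; plan-4 g7's cut S16257 (3), the `∃` form with the LINE PAIR discharged by L1-p3 g5's `SylvesterLines`
p717698, S16271).  Tree path `lean/Summits/Ventures/HodgeRepro/Tier4/Line4/SeesawPlaneData.lean`.  Mathlib-level; no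
literature; no `def`.

**`exists_seesawPlane_data_of_targetData (d : TargetData F E)`**: from the face datum alone — `d.H d.hH d.τ₀ d.C d.hC`
give the line pair (`exists_orthogonal_lines_of_sylvester`), `d.hani d.hdef` the rest (`exists_seesawPlane_data`,
SeesawPlaneInstance p717649) — a trace-zero `q` describing `E/E⁺`, scalars `a` with `a i ≠ 0`, `0 < Re τ₀(a i)`, and the
(8) carrier `SeesawDefinite q a (mk (τ₀ ∘ ι))`: the wall's `q _hq ht a _ha _hpos` and `hdef`, NO hypothesis.

RECORD: the identity instance of the second plane (`a 1 = a 0`, `a 3 = a 2`); (A3) — the similitude between two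
DIFFERENT planes, which lines the mixed classes live on — stays OPEN.  Nothing here says anything about the status of the
Hodge conjecture for CM abelian varieties, which is NOT proved (HC_CM is NOT proved by anyone in this repository).
-/

set_option autoImplicit false
noncomputable section
namespace Summit.Ventures.HodgeRepro.Tier4.Line4
open Summit.Ventures.HodgeRepro.Tier4 Summit.Ventures.HodgeRepro.Tier4.Common NumberField Matrix

section Data
variable {F E : Type} [Field F] [NumberField F] [IsGalois ℚ F] [IsCMField F]
  [Field E] [NumberField E] [IsGalois ℚ E] [IsCMField E]

/-- **The wall's `(q, a)` from the face datum alone** (C-L4-PLANE-INSTANCE ∘ C-L4-LINE-PAIR): `q.t = 0`, the unfolded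
`DescribesCM` clause, `a i ≠ 0`, `0 < Re τ₀(a i)` and `SeesawDefinite q a (mk (τ₀ ∘ ι))`, with no hypothesis beyond
`d : TargetData F E`. -/
theorem exists_seesawPlane_data_of_targetData (d : TargetData F E) :
    ∃ (q : QuadData ↥(maximalRealSubfield E)) (a : Fin 4 → ↥(maximalRealSubfield E)),
      q.t = 0 ∧
      (∃ ω : E, ω ^ 2 = algebraMap ↥(maximalRealSubfield E) E q.t * ω - algebraMap ↥(maximalRealSubfield E) E q.n ∧
        IsCMField.complexConj E ω = algebraMap ↥(maximalRealSubfield E) E q.t - ω ∧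
        IsCMField.complexConj E ω ≠ ω) ∧
      (∀ i, a i ≠ 0) ∧
      (∀ i, 0 < (d.τ₀ (algebraMap ↥(maximalRealSubfield E) E (a i))).re) ∧
      SeesawDefinite q a (InfinitePlace.mk (d.τ₀.comp (algebraMap ↥(maximalRealSubfield E) E))) :=
  exists_seesawPlane_data d (exists_orthogonal_lines_of_sylvester d.H d.hH d.τ₀ d.C d.hC)

end Data

end Summit.Ventures.HodgeRepro.Tier4.Line4

end
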